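import Mathlib
import HarnessLib
import Summits.HubbardSuperconductivity.HubbardSuperconductivity.Theorems.KLProgrammeKLRegimeVolumeLimitV11TowerDataWOfGridM
import Summits.HubbardSuperconductivity.HubbardSuperconductivity.Theorems.KLProgrammeKLRegimeTwoVolumeTowerBaseGridDataMOfTower

/-!
# Route `KLProgramme` — crux K3, VL child `KLRegimeVolumeLimitV17F2` (stmt-HubbardSuperconductivity-20440), window key «(VL)-SRC-WINDOW» (pen (R235)/(R246)):
# THE GRID ATOM `Hgrid‴` IS DISCHARGED BY NAME — `HB1W` is a theorem, and `stub_vl_towerData` (v12W) follows from TWO atoms `HE1 ⊕ Hmis` and the producer text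
# (cell gate-hubbard-kl, seat p3 g18; composition of k3c4-p1 g17's `hB1W_of_gridM` / `stub_vl_towerDataW_WF2_of_gridM` with `hgridM_of_towerV17F2` (p655488))

k3c4-p1 g17's `…V11HB1WOfGridM.hB1W_of_gridM` takes the grid atom `Hgrid‴` (eventual `TowerGridDataM` with its 21 constants, four `θ < 1` and five rates, from
the tower) as a hypothesis `HgridM`; `…TowerBaseGridDataMOfTower.hgridM_of_towerV17F2` (p3 g18) proves that text verbatim from `R.WF2` and the tower.  Hence:

* **`hB1W_of_towerV17F2`** — the atom `HB1W` (smoothed base defect at the `2r_L`-deep pins, `klKeyedDefectTSW … 1 0 k p w ≤ ε_M·η`) for every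
  `(G, P, Q, R)` with `R.WF2`, under regime doors, from the tower ALONE;
* **`stub_vl_towerDataW_WF2_of_twoAtoms`** — `stub_vl_towerData` (v12W: `∃ t ∈ (0,1], Nonempty (TowerDataTSW β U μ t)`) from `HE1` (E1 lineage: partition
  functions + alive read-out), `Hmis` (k3c4-p2 lineage: frame-mismatch rates) and the producer text `hSrc` — the interface of record loses the grid atom.

Proofs only; no definition.  Honest framing: compositions by name; nothing here asserts `HE1`, `Hmis`, the producer, any stub of 20440, K3, VL or superconductivity.
[cite: BenfattoGiulianiMastropietro2006, §2.7–§2.9, §3]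
-/

noncomputable section

namespace Summit.HubbardSuperconductivity.HubbardSuperconductivity.Theorems.TwoVolumeSource

set_option linter.dupNamespace false -- summit = problem name (single-conjunct summit), D-0017

open Finset Filter Topology Literature.MathematicalPhysics.QuantumLattice GrassmannAlgebra Literature.Probability.LatticeModels
  Literature.Probability.LatticeModels.BattleFederbush
open Summit.HubbardSuperconductivity.HubbardSuperconductivity.Theorems.KLRegimeSplit
open Summit.HubbardSuperconductivity.HubbardSuperconductivity.Theorems.KLProgrammeLegKernels
open Summit.HubbardSuperconductivity.HubbardSuperconductivity.Theorems.TwoPointAssembly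
open Summit.HubbardSuperconductivity.HubbardSuperconductivity.Theorems.EngineV8
open Summit.HubbardSuperconductivity.HubbardSuperconductivity.Theorems.TwoVolumeDefect
open Summit.HubbardSuperconductivity.HubbardSuperconductivity.Theorems.TorusFourierL2

set_option maxHeartbeats 400000 in -- long binders
/-- **THE ATOM `HB1W` FROM THE TOWER ALONE** (`hB1W_of_gridM` ∘ `hgridM_of_towerV17F2`). [folklore: composition; cite: BenfattoGiulianiMastropietro2006, §2.7 (2.70)–(2.71a), §3] -/
theorem hB1W_of_towerV17F2
    (G : GeoConsts) (P : SplitConsts) (Q : EngConsts) (R : RenConsts) (hG : G.WF) (hP : P.WF) (hQ : Q.WF) (hR2 : R.WF2) :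
    ∃ c₇ : ℝ, 0 < c₇ ∧ ∀ c : ℝ, 0 < c → c ≤ c₇ → ∃ U₇ : ℝ, 0 < U₇ ∧
      ∀ μ ∈ klWindowC, ∀ U : ℝ, 0 < U → U ≤ U₇ → ∀ β : ℝ, klBetaMin ≤ β → β ≤ Real.exp (c / U ^ 2) →
        ∀ (K : TrigPolyC4v) (Lstar : ℕ) (Mstar : ℕ → ℕ), TowerP klPredsV17F2 G P Q R β U μ K Lstar Mstar →
        ∃ M₂ : ℕ → ℕ → ℕ, ∀ (k : ℕ) (η : ℝ), 0 < η → ∃ L₂ : ℕ, ∀ (L b M : ℕ) [NeZero L] [NeZero (b * L)] [NeZero M], L₂ ≤ L → M₂ L b ≤ M →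
          ∀ (p : Fin k) (w : SrcLabel (b * L) M 0),
            (∀ i, 2 * (L / (4 * nScales β + 7)) ≤ (w.1.1.2 i).val % L ∧ (w.1.1.2 i).val % L + 2 * (L / (4 * nScales β + 7)) < L) →
            klKeyedDefectTSW L b M β U μ (klFlowFrameU L M β U μ (nScales β + 1)) (klFlowFrameU (b * L) M β U μ (nScales β + 1)) 1 0 k p w ≤
              imagTimeWeight β M * η :=
  hB1W_of_gridM (fun G P Q R _ _ _ hR2 => hgridM_of_towerV17F2 G P Q R hR2) G P Q R hG hP hQ hR2

set_option maxHeartbeats 1600000 in -- long binders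
/-- **`stub_vl_towerData` (v12W) FROM `HE1`, `Hmis` AND THE PRODUCER TEXT** — the grid atom discharged by `hgridM_of_towerV17F2`.
[folklore: composition; cite: BenfattoGiulianiMastropietro2006, §2.7-§2.9 and §3] -/
theorem stub_vl_towerDataW_WF2_of_twoAtoms
    (HE1 : ∀ (G : GeoConsts) (P : SplitConsts) (Q : EngConsts) (R : RenConsts), G.WF → P.WF → Q.WF → R.WF2 →
      ∃ C₀ : ℝ, 0 ≤ C₀ ∧
        ∃ c₇ : ℝ, 0 < c₇ ∧ ∀ c : ℝ, 0 < c → c ≤ c₇ → ∃ U₇ : ℝ, 0 < U₇ ∧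
          ∀ μ ∈ klWindowC, ∀ U : ℝ, 0 < U → U ≤ U₇ → ∀ β : ℝ, klBetaMin ≤ β → β ≤ Real.exp (c / U ^ 2) →
            ∀ (K : TrigPolyC4v) (Lstar : ℕ) (Mstar : ℕ → ℕ), TowerP klPredsV17F2 G P Q R β U μ K Lstar Mstar →
            ∃ S₀ : ℕ → ℕ → ℝ, (∀ j m, 0 ≤ S₀ j m) ∧ (∀ j, j ≤ nScales β → ∀ m, 1 ≤ m → S₀ j (2 * m) ≤ C₀ * klWtBudget P Q U (j + 1) (2 * m)) ∧
            ∃ L₂ : ℕ, ∃ M₂ : ℕ → ℕ, ∀ (L M : ℕ) [NeZero L] [NeZero M], L₂ ≤ L → M₂ L ≤ M →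
              (∀ k, k ≤ nScales β → hubbardEffPartitionFnCT L M β U μ 0 (klFlowFrameU L M β U μ (nScales β + 1)) (klScale klE0 (k + 1)) ≠ 0) ∧
              (∀ j, j ≤ nScales β → ∀ (m : ℕ) (q : Fin m) (w : SpaceTimeIdx L M × SectorLeg (sectorCount j)),
                klWtPinnedSumAt L M β μ (klFlowFrameU L M β U μ (nScales β + 1)) j j m (klEffectiveAction L M β U μ (klFlowFrameU L M β U μ (nScales β + 1)) klE0 (j + 1)) q w ≤ S₀ j m))
    (Hmis : ∀ (G : GeoConsts) (P : SplitConsts) (Q : EngConsts) (R : RenConsts), G.WF → P.WF → Q.WF → R.WF2 →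
        ∃ c₇ : ℝ, 0 < c₇ ∧ ∀ c : ℝ, 0 < c → c ≤ c₇ → ∃ U₇ : ℝ, 0 < U₇ ∧
          ∀ μ ∈ klWindowC, ∀ U : ℝ, 0 < U → U ≤ U₇ → ∀ β : ℝ, klBetaMin ≤ β → β ≤ Real.exp (c / U ^ 2) →
            ∀ (K : TrigPolyC4v) (Lstar : ℕ) (Mstar : ℕ → ℕ), TowerP klPredsV17F2 G P Q R β U μ K Lstar Mstar →
            ∃ (sE cR cC δ : ℕ → ℕ → ℝ),
              (∀ j L, 0 ≤ sE j L ∧ 0 ≤ cR j L ∧ 0 ≤ cC j L ∧ 0 ≤ δ j L ∧ cR j L ≤ 1 ∧ cC j L ≤ 1 ∧ δ j L ≤ 1) ∧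
              (∀ j, Tendsto (sE j) atTop (𝓝 0) ∧ Tendsto (cR j) atTop (𝓝 0) ∧ Tendsto (cC j) atTop (𝓝 0) ∧ Tendsto (δ j) atTop (𝓝 0)) ∧
            ∃ L₂ : ℕ, ∃ M₂ : ℕ → ℕ → ℕ, ∀ (L b M : ℕ) [NeZero L] [NeZero (b * L)] [NeZero M], L₂ ≤ L → M₂ L b ≤ M →
              (∀ j, j < nScales β → ∀ x y, ‖(klStepCov (b * L) M β μ (klFlowFrameU (b * L) M β U μ (nScales β + 1)) j - klStepCov (b * L) M β μ (klFlowFrameU L M β U μ (nScales β + 1)) j) x y‖ ≤ sE j L) ∧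
              (∀ j, j < nScales β → ∀ x, ∑ y, ‖(klStepCov (b * L) M β μ (klFlowFrameU (b * L) M β U μ (nScales β + 1)) j - klStepCov (b * L) M β μ (klFlowFrameU L M β U μ (nScales β + 1)) j) x y‖ ≤
                cR j L / imagTimeWeight β M) ∧
              (∀ j, j < nScales β → ∀ y, ∑ x, ‖(klStepCov (b * L) M β μ (klFlowFrameU (b * L) M β U μ (nScales β + 1)) j - klStepCov (b * L) M β μ (klFlowFrameU L M β U μ (nScales β + 1)) j) x y‖ ≤
                cC j L / imagTimeWeight β M) ∧
              (∀ j, j ≤ nScales β → ∀ x, ∑ y, ‖klTowerTransfer (b * L) M β μ (klFlowFrameU (b * L) M β U μ (nScales β + 1)) j x y - klTowerTransfer (b * L) M β μ (klFlowFrameU L M β U μ (nScales β + 1)) j x y‖ ≤ δ j L) ∧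
              (∀ j, j ≤ nScales β → ∀ y, ∑ x, ‖klTowerTransfer (b * L) M β μ (klFlowFrameU (b * L) M β U μ (nScales β + 1)) j x y - klTowerTransfer (b * L) M β μ (klFlowFrameU L M β U μ (nScales β + 1)) j x y‖ ≤ δ j L))
    (hSrc : ∀ (P : SplitConsts) (R : RenConsts), P.WF → R.WF2 →
      ∃ Q' : EngConsts, 0 ≤ Q'.CE ∧ ∃ c₀ : ℝ, 0 < c₀ ∧ ∀ c : ℝ, 0 < c → c ≤ c₀ → ∃ U₀ : ℝ, 0 < U₀ ∧
        ∀ μ ∈ klWindowC, ∀ U : ℝ, 0 < U → U ≤ U₀ → ∀ β : ℝ, klBetaMin ≤ β → β ≤ Real.exp (c / U ^ 2) →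
          ∃ A : ℕ → ℕ → ℝ, ∃ L₁ : ℕ, ∃ M₁ : ℕ → ℕ, ∀ (L M : ℕ) [NeZero L] [NeZero M], L₁ ≤ L → M₁ L ≤ M →
            ∀ j : ℕ, j + 1 ≤ nScales β + 1 →
              SourceProfilesAtLev L M (klSrcBudget P Q' U A (j + 1)) β U μ (klFlowFrameU L M β U μ (nScales β + 1)) j j (j + 1))
    (G : GeoConsts) (P : SplitConsts) (Q : EngConsts) (R : RenConsts) (hG : G.WF) (hP : P.WF) (hQ : Q.WF) (hR2 : R.WF2) :
    ∃ c₅ : ℝ, 0 < c₅ ∧ ∀ c : ℝ, 0 < c → c ≤ c₅ → ∃ U₀ : ℝ, 0 < U₀ ∧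
      ∀ μ ∈ klWindowC, ∀ U : ℝ, 0 < U → U ≤ U₀ → ∀ β : ℝ, klBetaMin ≤ β → β ≤ Real.exp (c / U ^ 2) →
        ∀ K : TrigPolyC4v, klPredsV17F2.frameOK R U (nScales β) μ K →
          ∀ (Lstar : ℕ) (Mstar : ℕ → ℕ), TowerP klPredsV17F2 G P Q R β U μ K Lstar Mstar →
            ∃ t : ℝ, 0 < t ∧ t ≤ 1 ∧ Nonempty (TowerDataTSW β U μ t) :=
  stub_vl_towerDataW_WF2_of_gridM HE1 Hmis (fun G P Q R _ _ _ hR2 => hgridM_of_towerV17F2 G P Q R hR2) hSrc G P Q R hG hP hQ hR2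

end Summit.HubbardSuperconductivity.HubbardSuperconductivity.Theorems.TwoVolumeSource

end
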